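import Summits.CriticalPhenomena.PercolationContinuityZ3.Theorems.PercNearOneGluingNoHeavyLowerTailWorstPairExchangeCex
import Summits.CriticalPhenomena.PercolationContinuityZ3.Theorems.PercNearOneGluingNoHeavyLowerTailHullPortLSLofSP
import HarnessLib

/-!
# `NoHeavyLowerTail` (stmt-CriticalPhenomena-4575) — hull-port line: the LOCALIZED SELECTION LEMMA (LSL) is FALSE
# (certified 8-vertex, 15-pair, two-weight witness)

Support file (prover `prim-hp-1`, hull-port / coupling line; `--supports stmt-CriticalPhenomena-4575`).  Computational
(`native_decide` on `2¹⁵`-term exact rational sums; evaluation pattern of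
`PercNearOneGluingNoHeavyLowerTailLocalizedExchangeCex.lean`).  No definitions, no named facts, no sorries.

**Background.**  The hull-port programme (crux memo run/shared/lean/prim/prim-hp-1/HULLPORT-COUPLING.md §15–§20) pinned the
hypothesis-free half `(T⁻)` of the pair atom to the LOCALIZED SELECTION LEMMA
  (LSL)  `μ(D_z ∩ Ψ_b) ≤ max(μ(D_z ∩ R_{x₁}), μ(D_z ∩ R_{x₂}))`,
`D_z = {z ↮ x₁} ∩ {z ↮ x₂}`, `R_v = {|π(v)| ≤ j}` (`π(v)` = relays joined to `v`, `v` counted if it is a relay),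
`Ψ_b = [b ∈ C(x₁) ∪ C(x₂) : R_b] ∨ [b ∉ C(x₁) ∪ C(x₂) : |π(x₁) ∪ π(x₂)| ≤ j]` ("the piece of the glued cluster selected by the marker
`b` is light"); the tree has the kernel-checked reductions `HullPort.threeCluster_scenario_of_LSL` (`(T⁻)_σ ⟸` LSL) and
`HullPort.lsl_pair_of_exchange`, `HullPort.lsl_of_sp` (LSL `⟸` the mirror-worlds exchange (SP)).  Without the guard `z`, LSL is the selection
lemma `HullPort.selection_pair_core` (a theorem, BHK 2006 Thm 1.5).  LSL had no violation in the exhaustive weighted census `n ≤ 6`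
(1.7·10⁷ instances), the `p = ½` exhaustive census `n ≤ 6` and ≈ 10⁵ adversarial climbs (ttrl `sellemma`, `k3cells/SPLSL.md`).

**This file: LSL is false.**  Witness W5 of ttrl2/cp-hp7 (run/shared/lean/ttrl/k3cells/SPLSL.md RESULT 7, found by an `x₁ ↔ x₂`
mirror-symmetric annealer on balanced mirror worlds; three exact evaluators agree, and the seat's brute force as well):
`Fin 8`, `x₁ = 0`, `x₂ = 1`, `z = 2`, `b = 3`, relays `A = {0, 1, 6, 7}` (the observers are relays; `b`, `z` are not), level `j = 1`;
weights `999/1000` on `{0,3},{0,4},{0,6},{1,3},{1,5},{1,7},{2,4},{2,5}` and `1/2` on `{2,6},{2,7},{3,4},{3,5},{4,5},{4,7},{5,6}`, all other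
pairs `0`.  Exactly: `μ(D_z ∩ R_{x₁}) = μ(D_z ∩ R_{x₂}) = 49162983942989/(128·10²⁴)` and `μ(D_z ∩ Ψ_b) = 50079868000002/(128·10²⁴)`
(ratio `1.01865`; `μ(D_z) ≈ 3.3·10⁻⁷`).  Mechanism: in each mirror world (`x₁` light / `x₂` heavy and conversely) the marker sits in the
LIGHT cluster with probability `0.509 > ½`, and the two worlds have equal mass.  Consequences (memo §28–§30): the `(T⁻)`-via-LSL route is
closed; relay doubling (memo §25) transports the witness to a relay marker at `n = 12`, `j = 3` (not certified here).

* `LocalizedSelectionCex.cnt_reachTable`, `cnt_reachTable_union` — relay counts (single cluster / glued pair) read off reach tables;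
* `LocalizedSelectionCex.real_R`, `real_Psi` — the three masses as exact weighted counts;
* `localizedSelection_cex` — the instance;  `localizedSelection_false` — `¬`LSL over all finite weighted graphs, relay sets, levels,
  observers, guards and markers (the form consumed by `HullPort.lsl_pair_of_exchange`);
* `mirrorWorlds_false` — corollary: the mirror-worlds exchange (SP) = (LSL-X) (hypothesis of `HullPort.lsl_of_sp`) is false too.
-/

namespace Summit.CriticalPhenomena.PercolationContinuityZ3.Theorems

open MeasureTheory
open Literature.Probability.LatticeModels Literature.Probability.Percolation
open Summit.CriticalPhenomena.PercolationContinuityZ3.Theorems.AdditiveGluing.Negative.Cert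
open scoped Classical

set_option maxHeartbeats 400000

namespace LocalizedSelectionCex

open WorstPairExchangeCex (real_eq_wcount)

/-- The relay count read off the reach table of a configuration is the relay count of the cluster. [this file] -/
theorem cnt_reachTable (ω : List (Fin 8 × Fin 8)) (x : Fin 8) :
    ((({0, 1, 6, 7} : Finset (Fin 8))).filter fun q : Fin 8 => ((reachTable 8 ω).getD x.val 0).testBit q.val = true).card =
      ((({0, 1, 6, 7} : Finset (Fin 8))).filter fun q => (↑(Eset ω) : Set (Sym2 (Fin 8))) ∈ openConn x q).card := by
  congr 1
  exact Finset.filter_congr fun q _ => testBit_reachTable_iff_mem_openConn ω x q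

/-- The relay count of the glued pair of clusters of `x, y` read off the reach table. [this file] -/
theorem cnt_reachTable_union (ω : List (Fin 8 × Fin 8)) (x y : Fin 8) :
    ((({0, 1, 6, 7} : Finset (Fin 8))).filter fun q : Fin 8 =>
        (((reachTable 8 ω).getD x.val 0).testBit q.val || ((reachTable 8 ω).getD y.val 0).testBit q.val) = true).card =
      ((({0, 1, 6, 7} : Finset (Fin 8))).filter fun q =>
        (↑(Eset ω) : Set (Sym2 (Fin 8))) ∈ openConn x q ∨ (↑(Eset ω) : Set (Sym2 (Fin 8))) ∈ openConn y q).card := by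
  congr 1
  refine Finset.filter_congr fun q _ => ?_
  rw [Bool.or_eq_true, testBit_reachTable_iff_mem_openConn ω x q, testBit_reachTable_iff_mem_openConn ω y q]

/-- `μ(D_z ∩ R_x)` (`z = 2`, observers `0, 1`, relays `{0,1,6,7}`, `j = 1`) as an exact weighted count. [this file] -/
theorem real_R {l : List (Fin 8 × Fin 8 × ℚ)} (hnd : (wPairs l).Nodup) (hq : ∀ e ∈ l, 0 ≤ e.2.2 ∧ e.2.2 ≤ 1) (x : Fin 8) :
    (prodBernoulli (wOfList l)).real
        {ω : BondConfig (Fin 8) | ω ∉ openConn (0 : Fin 8) (2 : Fin 8) ∧ ω ∉ openConn (1 : Fin 8) (2 : Fin 8) ∧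
          ((({0, 1, 6, 7} : Finset (Fin 8))).filter fun q => ω ∈ openConn x q).card ≤ 1} =
      ((((wtabs 8 l).map fun t => if (!((t.1).getD 0 0).testBit 2 && !((t.1).getD 1 0).testBit 2 &&
          Nat.ble (((({0, 1, 6, 7} : Finset (Fin 8))).filter fun q : Fin 8 => ((t.1).getD x.val 0).testBit q.val = true).card) 1)
          then t.2 else 0).sum : ℚ) : ℝ) := by
  refine real_eq_wcount hnd hq (fun tb => !((tb).getD 0 0).testBit 2 && !((tb).getD 1 0).testBit 2 &&
      Nat.ble (((({0, 1, 6, 7} : Finset (Fin 8))).filter fun q : Fin 8 => ((tb).getD x.val 0).testBit q.val = true).card) 1) _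
    fun ω => ?_
  have h02 : ((reachTable 8 ω).getD 0 0).testBit 2 = true ↔ (↑(Eset ω) : Set (Sym2 (Fin 8))) ∈ openConn (0 : Fin 8) (2 : Fin 8) :=
    testBit_reachTable_iff_mem_openConn ω 0 2
  have h12 : ((reachTable 8 ω).getD 1 0).testBit 2 = true ↔ (↑(Eset ω) : Set (Sym2 (Fin 8))) ∈ openConn (1 : Fin 8) (2 : Fin 8) :=
    testBit_reachTable_iff_mem_openConn ω 1 2
  have hcx : ((({0, 1, 6, 7} : Finset (Fin 8))).filter fun q : Fin 8 => (((reachTable 8 ω)).getD x.val 0).testBit q.val = true).card =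
      ((({0, 1, 6, 7} : Finset (Fin 8))).filter fun q => (↑(Eset ω) : Set (Sym2 (Fin 8))) ∈ openConn x q).card := cnt_reachTable ω x
  rw [hcx, Bool.and_eq_true, Bool.and_eq_true, Bool.not_eq_true', Bool.not_eq_true', Nat.ble_eq, Set.mem_setOf_eq]
  constructor
  · rintro ⟨⟨h1, h2⟩, h3⟩
    refine ⟨fun h => ?_, fun h => ?_, h3⟩
    · rw [h02.2 h] at h1; exact Bool.noConfusion h1
    · rw [h12.2 h] at h2; exact Bool.noConfusion h2
  · rintro ⟨h1, h2, h3⟩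
    refine ⟨⟨?_, ?_⟩, h3⟩
    · cases h : ((reachTable 8 ω).getD 0 0).testBit 2
      · rfl
      · exact absurd (h02.1 h) h1
    · cases h : ((reachTable 8 ω).getD 1 0).testBit 2
      · rfl
      · exact absurd (h12.1 h) h2

/-- `μ(D_z ∩ Ψ_b)` (`z = 2`, observers `0, 1`, marker `b = 3`, relays `{0,1,6,7}`, `j = 1`) as an exact weighted count.
[this file] -/
theorem real_Psi {l : List (Fin 8 × Fin 8 × ℚ)} (hnd : (wPairs l).Nodup) (hq : ∀ e ∈ l, 0 ≤ e.2.2 ∧ e.2.2 ≤ 1) :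
    (prodBernoulli (wOfList l)).real
        {ω : BondConfig (Fin 8) | ω ∉ openConn (0 : Fin 8) (2 : Fin 8) ∧ ω ∉ openConn (1 : Fin 8) (2 : Fin 8) ∧
          (((ω ∈ openConn (0 : Fin 8) (3 : Fin 8) ∨ ω ∈ openConn (1 : Fin 8) (3 : Fin 8)) ∧
              ((({0, 1, 6, 7} : Finset (Fin 8))).filter fun q => ω ∈ openConn (3 : Fin 8) q).card ≤ 1) ∨
            (ω ∉ openConn (0 : Fin 8) (3 : Fin 8) ∧ ω ∉ openConn (1 : Fin 8) (3 : Fin 8) ∧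
              ((({0, 1, 6, 7} : Finset (Fin 8))).filter fun q =>
                ω ∈ openConn (0 : Fin 8) q ∨ ω ∈ openConn (1 : Fin 8) q).card ≤ 1))} =
      ((((wtabs 8 l).map fun t => if (!((t.1).getD 0 0).testBit 2 && !((t.1).getD 1 0).testBit 2 &&
          ((((t.1).getD 0 0).testBit 3 || ((t.1).getD 1 0).testBit 3) &&
              Nat.ble (((({0, 1, 6, 7} : Finset (Fin 8))).filter fun q : Fin 8 => ((t.1).getD 3 0).testBit q.val = true).card) 1 ||
            !((t.1).getD 0 0).testBit 3 && !((t.1).getD 1 0).testBit 3 &&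
              Nat.ble (((({0, 1, 6, 7} : Finset (Fin 8))).filter fun q : Fin 8 =>
                (((t.1).getD 0 0).testBit q.val || ((t.1).getD 1 0).testBit q.val) = true).card) 1))
          then t.2 else 0).sum : ℚ) : ℝ) := by
  refine real_eq_wcount hnd hq (fun tb => !((tb).getD 0 0).testBit 2 && !((tb).getD 1 0).testBit 2 &&
      ((((tb).getD 0 0).testBit 3 || ((tb).getD 1 0).testBit 3) &&
          Nat.ble (((({0, 1, 6, 7} : Finset (Fin 8))).filter fun q : Fin 8 => ((tb).getD 3 0).testBit q.val = true).card) 1 ||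
        !((tb).getD 0 0).testBit 3 && !((tb).getD 1 0).testBit 3 &&
          Nat.ble (((({0, 1, 6, 7} : Finset (Fin 8))).filter fun q : Fin 8 =>
            (((tb).getD 0 0).testBit q.val || ((tb).getD 1 0).testBit q.val) = true).card) 1)) _
    fun ω => ?_
  have h02 : ((reachTable 8 ω).getD 0 0).testBit 2 = true ↔ (↑(Eset ω) : Set (Sym2 (Fin 8))) ∈ openConn (0 : Fin 8) (2 : Fin 8) :=
    testBit_reachTable_iff_mem_openConn ω 0 2
  have h12 : ((reachTable 8 ω).getD 1 0).testBit 2 = true ↔ (↑(Eset ω) : Set (Sym2 (Fin 8))) ∈ openConn (1 : Fin 8) (2 : Fin 8) :=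
    testBit_reachTable_iff_mem_openConn ω 1 2
  have h03 : ((reachTable 8 ω).getD 0 0).testBit 3 = true ↔ (↑(Eset ω) : Set (Sym2 (Fin 8))) ∈ openConn (0 : Fin 8) (3 : Fin 8) :=
    testBit_reachTable_iff_mem_openConn ω 0 3
  have h13 : ((reachTable 8 ω).getD 1 0).testBit 3 = true ↔ (↑(Eset ω) : Set (Sym2 (Fin 8))) ∈ openConn (1 : Fin 8) (3 : Fin 8) :=
    testBit_reachTable_iff_mem_openConn ω 1 3
  have n02 : ((reachTable 8 ω).getD 0 0).testBit 2 = false ↔ (↑(Eset ω) : Set (Sym2 (Fin 8))) ∉ openConn (0 : Fin 8) (2 : Fin 8) := by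
    rw [Bool.eq_false_iff, ne_eq, h02]
  have n12 : ((reachTable 8 ω).getD 1 0).testBit 2 = false ↔ (↑(Eset ω) : Set (Sym2 (Fin 8))) ∉ openConn (1 : Fin 8) (2 : Fin 8) := by
    rw [Bool.eq_false_iff, ne_eq, h12]
  have n03 : ((reachTable 8 ω).getD 0 0).testBit 3 = false ↔ (↑(Eset ω) : Set (Sym2 (Fin 8))) ∉ openConn (0 : Fin 8) (3 : Fin 8) := by
    rw [Bool.eq_false_iff, ne_eq, h03]
  have n13 : ((reachTable 8 ω).getD 1 0).testBit 3 = false ↔ (↑(Eset ω) : Set (Sym2 (Fin 8))) ∉ openConn (1 : Fin 8) (3 : Fin 8) := by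
    rw [Bool.eq_false_iff, ne_eq, h13]
  have hc3 : ((({0, 1, 6, 7} : Finset (Fin 8))).filter fun q : Fin 8 => (((reachTable 8 ω)).getD 3 0).testBit q.val = true).card =
      ((({0, 1, 6, 7} : Finset (Fin 8))).filter fun q => (↑(Eset ω) : Set (Sym2 (Fin 8))) ∈ openConn 3 q).card :=
    cnt_reachTable ω 3
  have hcU : ((({0, 1, 6, 7} : Finset (Fin 8))).filter fun q : Fin 8 =>
        ((((reachTable 8 ω)).getD 0 0).testBit q.val || (((reachTable 8 ω)).getD 1 0).testBit q.val) = true).card =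
      ((({0, 1, 6, 7} : Finset (Fin 8))).filter fun q =>
        (↑(Eset ω) : Set (Sym2 (Fin 8))) ∈ openConn 0 q ∨ (↑(Eset ω) : Set (Sym2 (Fin 8))) ∈ openConn 1 q).card :=
    cnt_reachTable_union ω 0 1
  rw [hc3, hcU]
  simp only [Bool.and_eq_true, Bool.or_eq_true, Bool.not_eq_true', Nat.ble_eq, Set.mem_setOf_eq, h03, h13, n02, n12,
    n03, n13]
  simp only [and_assoc]

/-- **From two checkable rational facts to the violating instance** of LSL on `Fin 8` (`x₁ = 0`, `x₂ = 1`, `z = 2`, `b = 3`,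
relays `{0,1,6,7}`, `j = 1`). [this file] -/
theorem violation_of_check (l : List (Fin 8 × Fin 8 × ℚ)) (hnd : (wPairs l).Nodup)
    (hq : ∀ e ∈ l, 0 ≤ e.2.2 ∧ e.2.2 ≤ 1)
    (hlt0 : ((wtabs 8 l).map fun t => if (!((t.1).getD 0 0).testBit 2 && !((t.1).getD 1 0).testBit 2 &&
          Nat.ble (((({0, 1, 6, 7} : Finset (Fin 8))).filter fun q : Fin 8 => ((t.1).getD (0 : Fin 8).val 0).testBit q.val = true).card) 1) then t.2 else 0).sum <
      ((wtabs 8 l).map fun t => if (!((t.1).getD 0 0).testBit 2 && !((t.1).getD 1 0).testBit 2 &&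
          ((((t.1).getD 0 0).testBit 3 || ((t.1).getD 1 0).testBit 3) &&
              Nat.ble (((({0, 1, 6, 7} : Finset (Fin 8))).filter fun q : Fin 8 => ((t.1).getD 3 0).testBit q.val = true).card) 1 ||
            !((t.1).getD 0 0).testBit 3 && !((t.1).getD 1 0).testBit 3 &&
              Nat.ble (((({0, 1, 6, 7} : Finset (Fin 8))).filter fun q : Fin 8 =>
                (((t.1).getD 0 0).testBit q.val || ((t.1).getD 1 0).testBit q.val) = true).card) 1)) then t.2 else 0).sum)
    (hlt1 : ((wtabs 8 l).map fun t => if (!((t.1).getD 0 0).testBit 2 && !((t.1).getD 1 0).testBit 2 &&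
          Nat.ble (((({0, 1, 6, 7} : Finset (Fin 8))).filter fun q : Fin 8 => ((t.1).getD (1 : Fin 8).val 0).testBit q.val = true).card) 1) then t.2 else 0).sum <
      ((wtabs 8 l).map fun t => if (!((t.1).getD 0 0).testBit 2 && !((t.1).getD 1 0).testBit 2 &&
          ((((t.1).getD 0 0).testBit 3 || ((t.1).getD 1 0).testBit 3) &&
              Nat.ble (((({0, 1, 6, 7} : Finset (Fin 8))).filter fun q : Fin 8 => ((t.1).getD 3 0).testBit q.val = true).card) 1 ||
            !((t.1).getD 0 0).testBit 3 && !((t.1).getD 1 0).testBit 3 &&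
              Nat.ble (((({0, 1, 6, 7} : Finset (Fin 8))).filter fun q : Fin 8 =>
                (((t.1).getD 0 0).testBit q.val || ((t.1).getD 1 0).testBit q.val) = true).card) 1)) then t.2 else 0).sum) :
    max ((prodBernoulli (wOfList l)).real
          {ω : BondConfig (Fin 8) | ω ∉ openConn (0 : Fin 8) (2 : Fin 8) ∧ ω ∉ openConn (1 : Fin 8) (2 : Fin 8) ∧
          ((({0, 1, 6, 7} : Finset (Fin 8))).filter fun q => ω ∈ openConn (0 : Fin 8) q).card ≤ 1})
        ((prodBernoulli (wOfList l)).real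
          {ω : BondConfig (Fin 8) | ω ∉ openConn (0 : Fin 8) (2 : Fin 8) ∧ ω ∉ openConn (1 : Fin 8) (2 : Fin 8) ∧
          ((({0, 1, 6, 7} : Finset (Fin 8))).filter fun q => ω ∈ openConn (1 : Fin 8) q).card ≤ 1}) <
      (prodBernoulli (wOfList l)).real
        {ω : BondConfig (Fin 8) | ω ∉ openConn (0 : Fin 8) (2 : Fin 8) ∧ ω ∉ openConn (1 : Fin 8) (2 : Fin 8) ∧
          (((ω ∈ openConn (0 : Fin 8) (3 : Fin 8) ∨ ω ∈ openConn (1 : Fin 8) (3 : Fin 8)) ∧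
              ((({0, 1, 6, 7} : Finset (Fin 8))).filter fun q => ω ∈ openConn (3 : Fin 8) q).card ≤ 1) ∨
            (ω ∉ openConn (0 : Fin 8) (3 : Fin 8) ∧ ω ∉ openConn (1 : Fin 8) (3 : Fin 8) ∧
              ((({0, 1, 6, 7} : Finset (Fin 8))).filter fun q =>
                ω ∈ openConn (0 : Fin 8) q ∨ ω ∈ openConn (1 : Fin 8) q).card ≤ 1))} := by
  rw [real_R hnd hq (0 : Fin 8), real_R hnd hq (1 : Fin 8), real_Psi hnd hq]
  exact max_lt (by exact_mod_cast hlt0) (by exact_mod_cast hlt1)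

end LocalizedSelectionCex

open LocalizedSelectionCex in
/-- **LSL fails: the instance.**  Weights on `Fin 8`: `999/1000` on `{0,3},{0,4},{0,6},{1,3},{1,5},{1,7},{2,4},{2,5}`, `1/2` on
`{2,6},{2,7},{3,4},{3,5},{4,5},{4,7},{5,6}`, all other pairs `0`; relays `{0,1,6,7}`, `j = 1`, `x₁ = 0`, `x₂ = 1`, `z = 2`, `b = 3`:
`max(μ(D_z ∩ R_0), μ(D_z ∩ R_1)) < μ(D_z ∩ Ψ_3)` (`49162983942989/(128·10²⁴)` twice versus `50079868000002/(128·10²⁴)`; exact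
rationals by `native_decide` over the `2¹⁵` configurations). [this file] -/
theorem localizedSelection_cex : ∃ w : Sym2 (Fin 8) → unitInterval,
    max ((prodBernoulli w).real
          {ω : BondConfig (Fin 8) | ω ∉ openConn (0 : Fin 8) (2 : Fin 8) ∧ ω ∉ openConn (1 : Fin 8) (2 : Fin 8) ∧
          ((({0, 1, 6, 7} : Finset (Fin 8))).filter fun q => ω ∈ openConn (0 : Fin 8) q).card ≤ 1})
        ((prodBernoulli w).real
          {ω : BondConfig (Fin 8) | ω ∉ openConn (0 : Fin 8) (2 : Fin 8) ∧ ω ∉ openConn (1 : Fin 8) (2 : Fin 8) ∧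
          ((({0, 1, 6, 7} : Finset (Fin 8))).filter fun q => ω ∈ openConn (1 : Fin 8) q).card ≤ 1}) <
      (prodBernoulli w).real
        {ω : BondConfig (Fin 8) | ω ∉ openConn (0 : Fin 8) (2 : Fin 8) ∧ ω ∉ openConn (1 : Fin 8) (2 : Fin 8) ∧
          (((ω ∈ openConn (0 : Fin 8) (3 : Fin 8) ∨ ω ∈ openConn (1 : Fin 8) (3 : Fin 8)) ∧
              ((({0, 1, 6, 7} : Finset (Fin 8))).filter fun q => ω ∈ openConn (3 : Fin 8) q).card ≤ 1) ∨
            (ω ∉ openConn (0 : Fin 8) (3 : Fin 8) ∧ ω ∉ openConn (1 : Fin 8) (3 : Fin 8) ∧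
              ((({0, 1, 6, 7} : Finset (Fin 8))).filter fun q =>
                ω ∈ openConn (0 : Fin 8) q ∨ ω ∈ openConn (1 : Fin 8) q).card ≤ 1))} :=
  ⟨_, violation_of_check
    [((0 : Fin 8), (3 : Fin 8), 999/1000), (0, 4, 999/1000), (0, 6, 999/1000), (1, 3, 999/1000), (1, 5, 999/1000),
      (1, 7, 999/1000), (2, 4, 999/1000), (2, 5, 999/1000), (2, 6, 1/2), (2, 7, 1/2), (3, 4, 1/2), (3, 5, 1/2),
      (4, 5, 1/2), (4, 7, 1/2), (5, 6, 1/2)]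
    (by decide)
    (by
      intro e he
      simp only [List.mem_cons, List.not_mem_nil, or_false] at he
      rcases he with rfl | rfl | rfl | rfl | rfl | rfl | rfl | rfl | rfl | rfl | rfl | rfl | rfl | rfl | rfl <;> norm_num)
    (by native_decide) (by native_decide)⟩

/-- **No-go: the localized selection lemma LSL of the hull-port programme is false.**  It is false that for every finite weighted
graph, relay set `A`, level `j`, observers `x₁, x₂`, guard `z` and marker `b` (all distinct),
`μ(D_z ∩ Ψ_b) ≤ max(μ(D_z ∩ R_{x₁}), μ(D_z ∩ R_{x₂}))` with `D_z = {x₁ ↮ z} ∩ {x₂ ↮ z}`, `R_x = {|π(x)| ≤ j}` and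
`Ψ_b = [b ∈ C(x₁) ∪ C(x₂) : |π(b)| ≤ j] ∨ [b ∉ C(x₁) ∪ C(x₂) : |π(x₁) ∪ π(x₂)| ≤ j]` — the conclusion of
`HullPort.lsl_pair_of_exchange` / `HullPort.lsl_of_sp` and the hypothesis shape of `HullPort.threeCluster_scenario_of_LSL`.
Witness `localizedSelection_cex` (observers relays, marker and guard not; ttrl2 W5).  [this file] -/
theorem localizedSelection_false :
    ¬ (∀ (n : ℕ) (w : Sym2 (Fin n) → unitInterval) (A : Finset (Fin n)) (j : ℕ) (x₁ x₂ z b : Fin n),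
      [x₁, x₂, z, b].Nodup →
      (prodBernoulli w).real {ω : BondConfig (Fin n) | ω ∉ openConn x₁ z ∧ ω ∉ openConn x₂ z ∧
          (((ω ∈ openConn x₁ b ∨ ω ∈ openConn x₂ b) ∧ (A.filter fun t => ω ∈ openConn b t).card ≤ j) ∨
            (ω ∉ openConn x₁ b ∧ ω ∉ openConn x₂ b ∧
              (A.filter fun t => ω ∈ openConn x₁ t ∨ ω ∈ openConn x₂ t).card ≤ j))} ≤
        max ((prodBernoulli w).real {ω : BondConfig (Fin n) | ω ∉ openConn x₁ z ∧ ω ∉ openConn x₂ z ∧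
                (A.filter fun t => ω ∈ openConn x₁ t).card ≤ j})
            ((prodBernoulli w).real {ω : BondConfig (Fin n) | ω ∉ openConn x₁ z ∧ ω ∉ openConn x₂ z ∧
                (A.filter fun t => ω ∈ openConn x₂ t).card ≤ j})) := by
  intro h
  obtain ⟨w, hgt⟩ := localizedSelection_cex
  have hle := h 8 w ({0, 1, 6, 7} : Finset (Fin 8)) 1 0 1 2 3 (by decide)
  exact absurd hle (not_le.2 hgt)

/-- **No-go (corollary): the mirror-worlds exchange (SP) = (LSL-X) is false as well.**  (SP) — the hypothesis `hSP` of
`HullPort.lsl_of_sp` and `hX` of `HullPort.lsl_pair_of_exchange` (crux memo HULLPORT-COUPLING.md §25, hp-7 memo HP7-GX-FAMILY §2b):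
`μ(D'∩G₋∩{x₁↔b})·μ(D'∩G₊∩{x₂↔b}) ≤ μ(D'∩G₋∩{x₁↮b})·μ(D'∩G₊∩{x₂↮b})` — implies LSL instance by instance (`HullPort.lsl_of_sp`), so the
LSL witness refutes it (ttrl2 k3cells/SPLSL.md reports direct (SP) witnesses from `n = 7` on). [this file] -/
theorem mirrorWorlds_false :
    ¬ (∀ (n : ℕ) (w : Sym2 (Fin n) → unitInterval) (A : Finset (Fin n)) (j : ℕ) (x₁ x₂ z b : Fin n),
      [x₁, x₂, z, b].Nodup →
      (prodBernoulli w).real {ω : BondConfig (Fin n) | (¬ (openGraph ω).Reachable z x₁ ∧ ¬ (openGraph ω).Reachable z x₂ ∧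
          ¬ (openGraph ω).Reachable x₁ x₂) ∧ ((A.filter fun q => ω ∈ openConn x₁ q).card ≤ j ∧
          j < (A.filter fun q => ω ∈ openConn x₂ q).card) ∧ (openGraph ω).Reachable x₁ b} *
        (prodBernoulli w).real {ω : BondConfig (Fin n) | (¬ (openGraph ω).Reachable z x₁ ∧ ¬ (openGraph ω).Reachable z x₂ ∧
          ¬ (openGraph ω).Reachable x₁ x₂) ∧ ((A.filter fun q => ω ∈ openConn x₂ q).card ≤ j ∧
          j < (A.filter fun q => ω ∈ openConn x₁ q).card) ∧ (openGraph ω).Reachable x₂ b} ≤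
      (prodBernoulli w).real {ω : BondConfig (Fin n) | (¬ (openGraph ω).Reachable z x₁ ∧ ¬ (openGraph ω).Reachable z x₂ ∧
          ¬ (openGraph ω).Reachable x₁ x₂) ∧ ((A.filter fun q => ω ∈ openConn x₁ q).card ≤ j ∧
          j < (A.filter fun q => ω ∈ openConn x₂ q).card) ∧ ¬ (openGraph ω).Reachable x₁ b} *
        (prodBernoulli w).real {ω : BondConfig (Fin n) | (¬ (openGraph ω).Reachable z x₁ ∧ ¬ (openGraph ω).Reachable z x₂ ∧
          ¬ (openGraph ω).Reachable x₁ x₂) ∧ ((A.filter fun q => ω ∈ openConn x₂ q).card ≤ j ∧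
          j < (A.filter fun q => ω ∈ openConn x₁ q).card) ∧ ¬ (openGraph ω).Reachable x₂ b}) := by
  intro h
  apply localizedSelection_false
  intro n w A j x₁ x₂ z b hnd
  have key := HullPort.lsl_of_sp w A x₁ x₂ z b j (h n w A j x₁ x₂ z b hnd)
  have ez : ∀ (x : Fin n) (ω : BondConfig (Fin n)), ω ∉ openConn x z ↔ ¬ (openGraph ω).Reachable z x := fun x ω => by
    simp only [openConn, Set.mem_setOf_eq]
    exact not_congr SimpleGraph.reachable_comm
  have e1 : {ω : BondConfig (Fin n) | ω ∉ openConn x₁ z ∧ ω ∉ openConn x₂ z ∧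
        (((ω ∈ openConn x₁ b ∨ ω ∈ openConn x₂ b) ∧ (A.filter fun t => ω ∈ openConn b t).card ≤ j) ∨
          (ω ∉ openConn x₁ b ∧ ω ∉ openConn x₂ b ∧
            (A.filter fun t => ω ∈ openConn x₁ t ∨ ω ∈ openConn x₂ t).card ≤ j))} =
      ({ω : BondConfig (Fin n) | ¬ (openGraph ω).Reachable z x₁ ∧ ¬ (openGraph ω).Reachable z x₂} ∩
        {ω : BondConfig (Fin n) | ((ω ∈ openConn x₁ b ∨ ω ∈ openConn x₂ b) ∧ (A.filter fun t => ω ∈ openConn b t).card ≤ j) ∨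
          (ω ∉ openConn x₁ b ∧ ω ∉ openConn x₂ b ∧
            (A.filter fun t => ω ∈ openConn x₁ t ∨ ω ∈ openConn x₂ t).card ≤ j)}) := by
    ext ω
    simp only [Set.mem_inter_iff, Set.mem_setOf_eq, ez]
    tauto
  have e2 : ∀ x : Fin n, {ω : BondConfig (Fin n) | ω ∉ openConn x₁ z ∧ ω ∉ openConn x₂ z ∧
        (A.filter fun t => ω ∈ openConn x t).card ≤ j} =
      {ω : BondConfig (Fin n) | ¬ (openGraph ω).Reachable z x₁ ∧ ¬ (openGraph ω).Reachable z x₂ ∧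
        (A.filter fun q => ω ∈ openConn x q).card ≤ j} := fun x => by
    ext ω
    simp only [Set.mem_setOf_eq, ez]
  rw [e1, e2 x₁, e2 x₂]
  exact key

end Summit.CriticalPhenomena.PercolationContinuityZ3.Theorems
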